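import Literature.MathematicalPhysics.QuantumFieldTheory.Balaban1983to89.B8SockP5uEBodyNestedPer
import Literature.MathematicalPhysics.QuantumFieldTheory.Balaban1983to89.B8Prop5UniqSectEWSrcPer

/-!
# `Balaban1983to89.B8SockP5uEBodyNestedSrcPer` — [Balaban1985RegularSpaces] Prop. 5 (1.109) p. 94 («such a configuration u′ is unique») for Theorem 4's
# datum (p. 95) at a NESTED member `Ω₀ = T_η ⊃ Ω₁ ⊃ … ⊃ Ω_k` ON THE TORUS (§3 p. 98), AT THEOREM 8's SOURCED GAUGE CONDITION (1.146) p. 101, EDITION γ′: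
# the provider BODY of the N05 knit's uniqueness socket `SP5u`, instance (ii) «Theorem 8's source» — brick U1″ of the interface request B8-P5-NESTED-SERVER
# (uniqueness half)

statement-level skeleton of published theorems with citation tags; proofs where landed; nothing here is a claim about the Yang–Mills mass gap

T. Bałaban, *Spaces of regular gauge field configurations on a lattice and gauge fixing conditions*, Commun. Math. Phys. **99** (1985) 75–102
`[Balaban1985RegularSpaces]` ("B8"; printed page = PDF page + 74): Prop. 5 (1.107)–(1.109) p. 94, Thm 4 p. 88 and p. 95 (the uniqueness paragraph), Thm 8
(1.146) p. 101 («there exists exactly one gauge transformation u defined on T₁⁽ᵑ⁾ … and such that …»), (1.67)–(1.69) p. 88, (1.112) p. 95, (1.29) p. 81,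
(1.31) + (1.35) p. 82, p. 77 (one-end-point bonds; «we admit the case when some domains Ω_j are equal to T_η»), (1.5)–(1.6) p. 77, Prop. 3 p. 87, (1.59)–(1.62)
pp. 86–87, §3 p. 98.  T. Bałaban, *Propagators for lattice gauge theories in a background field*, CMP **99** (1985) 389–434 `[Balaban1985BackgroundPropagators]`
("[4]"): Thm 3.1 p. 397, (3.24)–(3.25) p. 394, Thm 3.3 p. 398.  `[Balaban1985Averaging]` ("[3]"): Prop. 4 p. 38, (4) p. 18.  PDF held:
`paper:balaban1985-cmp99-regular-spaces-gauge-fixing`.  STATUS: published, refereed.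

CITATION HEADER (lean-in-tree rule).  Cell `lit-balaban`, seat `lit-balaban-p21` (gen 39), sub-row «G-B8-T2S» (R3 `stmt-QuantumFields-19200`, `--supports`, helper;
the consumers bear on `stmt-QuantumFields-27364`).  Interface request B8-P5-NESTED-SERVER (pub-ymgap dag-n05-c g17, 2026-08-28; lit-balaban lead g33 commission
`lit-balaban-p21/WAKE-B8P5NestedServerUniq.md`): serve the uniqueness socket `SP5u` :174–:194 of `B8Thm4CoreZdGF3HP2PerLanEGamma` (T5) at NESTED PERIODIC members —
instance (ii), the competitors' conditions being Theorem 8's (1.146) with a periodic source `f` (`LanF a U₀ f m W ↔ IsLandau146W …`).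

WHAT THIS FILE PROVES (one theorem, no `def`).
★ `sockP5uE_body_src_γ'_per` — this seat's zero-source body `B8SockP5uEBodyNestedPer.sockP5uE_body_γ'_per` VERBATIM with dag-n05-w4's sourced `ℤᵈ` body
`B8SockP5uEAssemblyBSrcGammaPrime.sockP5uE_body_of_join_b_src_γ'` diff applied token for token: a fixed source `f` with finite `|f|₍₋₂₎ ≤ m_f` on the `Ω_j`,
PERIODIC on the full period lattice `x + P • m`; each competitor's gauge-fixed field obeys THE MULTIPLIER FORM OF (1.146) at `k` levels
(`B8Eq138LandauZd.IsLandau146W`'s second clause, `Δ↾Ω₀[D*((iη)⁻¹ log U₁^{v⁻¹}) − f] = Q′ᵀμ`) and (1.29); the two smallness windows are read at `hE₂ + m_f∕2`;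
the multiplier clause of record for the engine carries `… − f` (the D*-identity `covDivB_logCfg_gaugeFixed` leaves the source untouched), its multiplier replaced
by a LEVEL-PERIODIC representative (`B8Thm2TorusServerPer.exists_levelPeriodic_multiplier`: the left side is periodic because `U₀`, `A′`, `λ` AND `f` are); engine
= this seat's periodic × sourced uniqueness JOIN `B8Prop5UniqSectEWSrcPer.hFP_unique_of_sectE_local_wb_src_per` BY NAME.  Everything else — RULING #4 laws
((U1) `g_leftB` at PERIODIC bounded functions, (U2) `c_left'` at LEVEL-PERIODIC multipliers, (1.91) `hQH` at LEVEL-PERIODIC families; `G′` periodic-valued, `𝔄`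
level-periodic-valued, `H′` periodicity-preserving), `Lʲ ∣ P`, shift-invariant `Λ_j`, the ABSTRACT datum gauge predicate `Lan k (U′^{u₁⁻¹})`, the SOURCED b9
input `SH59k` at the datum, `grad_bound_of_datum_src_γ'` ((1.35) in print's p. 77 ONE-END-POINT class, class law «box ⊂ Ω_{j−1}»), `|D*A′|₍₋₂₎ ≤ d·L²·(c⋆ + 2Sg)
≤ c_{DA}` — as in the zero-source body.  CONCLUSION unchanged: `∀ x, v x = w x`.

HONEST SCOPE.  Composition of landed theorems; Proposition 5 ∕ Theorem 8 ∕ [4] ∕ Sect. E are NOT re-proved; the [4] letters with their laws at periodic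
arguments, the sourced b9 lines at the datum, the source's size and the windows are DISPLAYED hypotheses (explicit and merely sufficient); the
level-periodic-multiplier premise of the per engine is DISCHARGED here; `d ≥ 2`, `L ≥ 2`, `Ω 0 = univ`, `𝔸` a C⋆-algebra.  Count-neutral; N05 ∕ `stub_PV3A` NOT
discharged; one finite `T⁴` programme at fixed `ε` — nothing continuum ∕ ℝ⁴ ∕ OS ∕ mass-gap ∕ Clay: the Yang–Mills mass gap is NOT proved.  No `sorry`, no `def`,
no `… : Prop` fact, no `instance`, no `notation`.

RELATED IN THE TREE, NOT DUPLICATED: `B8SockP5uEBodyNestedPer` (this seat; zero-source twin, instance (i)), `B8SockP5uEAssemblyBSrcGammaPrime` (dag-n05-w4; `ℤᵈ`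
sourced γ′ body), `B8Prop5SocketDatumSrcGammaPrime` (dag-n05-w4; USED), `B8Prop5UniqSectEWSrcPer` (this seat; USED), `B8Thm2TorusServerPer` (t2s-1; USED).
-/

noncomputable section

open NormedSpace
open scoped BigOperators

namespace Literature.MathematicalPhysics.QuantumFieldTheory.Balaban1983to89.B8SockP5uEBodyNestedSrcPer

open Complex (I)
open MatrixLog (mlog)
open B7Prop1Explicit B7Prop2Explicit B7Prop1Local B7Eq92Concrete
open B7Prop2Explicit (C0 c2')
open B7Prop3Flat (c3)
open B7Prop10General (C6 C4G)
open B7Prop9Flat (C5')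
open B7Eq78Linearization (conjR zdBlocking QprimeIter)
open B7Eq167Flat (InLambda)
open B8Ineq132 (covDerivFwd covDeriv InAk norm_conjR)
open B8Eq119TwistedAxial (Restr129 InAx bgT)
open B8Eq184Proof (gaugeExp cfgExp)
open B8Eq182Proof (gAd)
open B8Eq188Proof (frakF3)
open B8Lemma1NonAbelian (mulCfg)
open B8Eq140Level (SideTouches)
open B8Eq146AExpansion (iEta expCfg)
open B8Ineq130 (tlo thi)
open B8Thm2LogB (blockTop)
open B8Eq138LandauZd (IsLandau138 IsLandau138W IsLandau146W covDivB covLap QT logCfg)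
open B8Ineq125Concrete (C2p)
open B8Eq1117Concrete (XSpace)
open B8Eq1117KLevel (glev_on_towers_of_axial)
open B8SectEInLambdaWitness (witness_unitary_of_glev)
open B8Prop3GaugeFixedKLevel (expCfg_iEta_eq_cfgExp logField_spec mem_unitaryUnits_of_mgauge_eq)
open B8Eq155JBound (Jcur wsup expCfg_iEta_mem_unitaryUnits)
open B7Prop4GeneralLevels (linCovIter)
open B8ScaledSupNorm (bondNorm msup)
open B8Thm4AtLandau138 (mgauge_mgauge_inv)
open B8Thm4Concrete (mulCfg_eq_mul)
open B8Prop5ContractionKLevel (Bd2 Mc Kc)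
open B8LambdaSpaceKLevel (wt wt_nonneg)
open B8Prop5GaugeParamKLevel (norm_covDeriv_eq)
open B8Prop5KLevelLetters (covDivB_logCfg_gaugeFixed)
open B8Prop5SocketDatum (exists_masked_datum bd2_covDivB_of_grad sideTouches_pair_of_mem sideTouches_of_tower_bond h33_of_inAk hP_of_datum
  h69_of_datum hA_of_datum)
open B8Prop5SocketDatumSrcGammaPrime (grad_bound_of_datum_src_γ')
open B8Prop5UniqSectEWSrcPer (hFP_unique_of_sectE_local_wb_src_per)
open B8Prop5NeumannPeriodic (covDivB_per)
open B8Thm2TorusSupplier (mgauge_periodic)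
open B8Thm2TorusLettersPerConv (covLap_per)
open B8Thm2TorusServerPer (exists_levelPeriodic_multiplier gaugeExp_per)

-- `Site` alone could resolve to the torus sites of `Setup.lean`; re-export the `ℤ^d` sites of `B7Prop1Explicit`.
export B7Prop1Explicit (Site)

variable {d : ℕ} {𝔸 : Type*} [CStarAlgebra 𝔸] [Nontrivial 𝔸]

/-! ## §1 The provider body of the uniqueness socket at one nested periodic member, Theorem 8's source, edition γ′ -/

/-- ★ **PROPOSITION 5's UNIQUENESS CLAUSE (1.109) FOR THEOREM 4's DATUM AT A NESTED MEMBER ON THE TORUS, AT THEOREM 8's SOURCED GAUGE CONDITION (1.146), THE [4]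
LETTERS' LAWS AT PERIODIC ARGUMENTS, EDITION γ′** (Prop. 5 (1.109) p. 94 used as on p. 95; Thm 8 p. 101; §3 p. 98; the body of the N05 knit's uniqueness socket
`SP5u` at one member with `Ω₀ = T_η`, instance «Theorem 8's source»).  `B8SockP5uEBodyNestedPer.sockP5uE_body_γ'_per` VERBATIM except: a fixed source `f`,
PERIODIC on the full period lattice, with finite `|f|₍₋₂₎ ≤ m_f` on the `Ω_j`; each competitor's gauge-fixed field `U₁^{v⁻¹}`, `U₁ = U′^{u₁⁻¹}`, obeys THE
MULTIPLIER FORM OF (1.146) at `k` levels — `Δ↾Ω₀[D*((iη)⁻¹ log U₁^{v⁻¹}) − f] = Q′ᵀμ` (`IsLandau146W`'s second clause) — and (1.29); the smallness windows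
(1.103)∕(1.106) are read at `hE₂ + m_f∕2`.  CLAIM: two competitors `v = e^{iλ}`, `w = e^{iμ}` in print's domain «|λ|, |Dλ|₍₋₁₎ < c_u», periodic exponents,
coincide.  PROOF: the periodic datum dictionary and the (1.69) gradient member exactly as in the zero-source body; each competitor's clause rewritten by the
D*-identity into the engine's sourced multiplier clause (source untouched), its multiplier replaced by a level-periodic representative (the left side is
periodic since `U₀`, `A′`, `λ`, `f` are); then `B8Prop5UniqSectEWSrcPer.hFP_unique_of_sectE_local_wb_src_per`.
[cite: Balaban1985RegularSpaces, Prop. 5 (1.109) p.94, Thm 4 p.88, p.95 (uniqueness paragraph), Thm 8 (1.146) p.101, (1.67)–(1.69) p.88, (1.112) p.95, (1.29) p.81, (1.35) p.82, p.77, Prop. 3 p.87, (1.59)–(1.62) pp.86–87, §3 p.98; Balaban1985Averaging, Prop. 4 p.38, (166)–(167) p.44; Balaban1985BackgroundPropagators, Thm 3.1 p.397, (3.24)–(3.25) p.394, Thm 3.3 p.398] -/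
theorem sockP5uE_body_src_γ'_per (hd2 : 2 ≤ d) {L : ℕ} (hL : 2 ≤ L) {η : ℝ} (hη : 0 < η) {k : ℕ} (hk : 1 ≤ k) (P : ℤ)
    -- the member's geometry (`Ω 0 = univ` sub-family)
    {Ω : ℕ → Set (Site d)} (hΩ : ∀ j, Ω (j + 1) ⊆ Ω j) (hΩ0 : Ω 0 = Set.univ) {Λs : ℕ → ℕ → Set (Site d)} {Λb : ℕ → ℕ → Set (Site d × Fin d)}
    -- PRINT's box law for the class read by the sourced b9 lines: the locality box of a level-`j` class bond lies in `Ω_{j−1}` ((1.31); level 0: `Ω₀`)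
    (hbox : ∀ m, m ≤ k → ∀ j, j ≤ m → ∀ c ∈ Λb m j, ∀ x, InBox (loK L j c.1) (bondHiK L j c.1 c.2) x → x ∈ Ω (j - 1))
    (hclass : ∀ m, m ≤ k → ∀ j, j ≤ m → ∀ c ∈ Λb m j,
      (c.1 ∈ Λs m j ∧ c.1 + e c.2 ∈ Λs m j) ∨
      (∃ j', j = j' + 1 ∧ (∀ x, (L : ℤ) • c.1 ≤ x → x ≤ (L : ℤ) • c.1 + blockTop L → x ∈ Λs m j') ∧ c.1 + e c.2 ∈ Λs m j) ∨
      (∃ j', j = j' + 1 ∧ c.1 ∈ Λs m j ∧ (∀ x, (L : ℤ) • (c.1 + e c.2) ≤ x → x ≤ (L : ℤ) • (c.1 + e c.2) + blockTop L → x ∈ Λs m j')))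
    (htower : ∀ j, j ≤ k → ∀ y ∈ Λs k j, ∀ x, InBox (tlo L y j) (thi L y j) x → x ∈ Ω j)
    -- the torus: `Lʲ ∣ P`, shift-invariant `Λ_j`
    (hdiv : ∀ j, j ≤ k → ((L : ℤ) ^ j ∣ P))
    (hΛ : ∀ j, j ≤ k → ∀ (y : Site d) (i : Fin d), y + (P / (L : ℤ) ^ j) • e i ∈ Λs k j ↔ y ∈ Λs k j)
    -- the socket's antecedents: constants, (1.33), (1.34), (1.35) in print's p. 77 ONE-END-POINT class; `U₀`, `U′` periodic
    {α₀ α₁ B₀ cs α₄ cu : ℝ} (hα₀ : 0 < α₀) (hα₁ : 0 < α₁) (hB₀ : 0 < B₀)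
    (hcs : cs = 5 * (d : ℝ) * L * B₀ * (α₀ + α₁)) (hα₄ : 0 < α₄)
    {U₀ U' : Site d → Fin d → 𝔸ˣ} (hU₀ : ∀ x κ, U₀ x κ ∈ unitaryUnits 𝔸) (hU' : ∀ x κ, U' x κ ∈ unitaryUnits 𝔸)
    (hU₀per : ∀ x m : Site d, U₀ (x + P • m) = U₀ x) (hU'per : ∀ x m : Site d, U' (x + P • m) = U' x)
    (h33 : InAk L k η α₀ Ω U₀) (h34 : InAk L k η α₀ Ω (mulCfg U' U₀)) (hAx : ∀ m', m' ≤ k → InAx L m' (Λs m') U₀ (mulCfg U' U₀))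
    (h135 : ∀ j, j ≤ k → ∀ (z : Site d) (μ : Fin d),
        ((∀ x, InBox (tlo L z j) (thi L z j) x → x ∈ Ω j) ∨ (∀ x, InBox (tlo L (z + e μ) j) (thi L (z + e μ) j) x → x ∈ Ω j)) →
      ‖(avgIter L (mulCfg U' U₀) j z μ : 𝔸) - (avgIter L U₀ j z μ : 𝔸)‖ ≤ α₁)
    -- the datum of Theorem 4's uniqueness paragraph: `u₁` periodic with (1.29), an ABSTRACT gauge predicate `Lan k` for `U₁ = U′^{u₁⁻¹}`, the (1.62)-shape
    {u₁ : Site d → 𝔸ˣ} (hu₁ : ∀ x, u₁ x ∈ unitaryUnits 𝔸) (hu₁per : ∀ x m : Site d, u₁ (x + P • m) = u₁ x)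
    (h129 : Restr129 L k (Λs k) U₀ u₁)
    (Lan : ℕ → (Site d → Fin d → 𝔸ˣ) → Prop) (hLan : Lan k (mgauge U₀ u₁⁻¹ U'))
    (hdat : ∃ A₁ : Site d → Fin d → 𝔸, ∀ j, j ≤ k → ∀ (x : Site d) (κ : Fin d), SideTouches (Ω j) x κ →
      mgauge U₀ u₁⁻¹ U' x κ = cfgExp η A₁ x κ ∧ ‖A₁ x κ‖ ≤ cs * ((L : ℝ) ^ j * η)⁻¹)
    -- THE SOURCED b9 INPUT AT THE DATUM, TOP LEVEL `k` (the two (1.59)-lines with source terms `Sa`, `Sg` for every PERIODIC masked exponent of `U′^{u₁⁻¹}` —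
    -- what the knit's guarded `SH59src` delivers at `(k, u₁, U′^{u₁⁻¹})`)
    {Sa Sg : ℝ} (hSg : 0 ≤ Sg)
    (SH59k : ∀ A' : Site d → Fin d → 𝔸, (∀ x m : Site d, A' (x + P • m) = A' x) → (∀ y τ, IsSelfAdjoint (A' y τ)) →
      (∀ j, j ≤ k → ∀ (y : Site d) (τ : Fin d), SideTouches (Ω j) y τ →
        mgauge U₀ u₁⁻¹ U' y τ = cfgExp η A' y τ ∧ ‖A' y τ‖ ≤ cs * ((L : ℝ) ^ j * η)⁻¹) →
      (∀ (y : Site d) (τ : Fin d), (∀ j, j ≤ k → ¬ SideTouches (Ω j) y τ) → A' y τ = 0) →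
      msup L k η (-(1 : ℝ)) (fun j (b : Site d × Fin d) => SideTouches (Ω j) b.1 b.2) (fun b => A' b.1 b.2)
          ≤ B₀ * (bondNorm L k η (-(3 : ℝ)) Ω (fun x μ => Jcur η U₀ A' μ x)
          + wsup 1 (fun p : {p : ℕ × (Site d × Fin d) // p.1 ≤ k ∧ p.2 ∈ Λb k p.1} =>
          linCovIter L U₀ (iEta η A') p.1.1 p.1.2.1 p.1.2.2)) + Sa ∧
        msup L k η (-(2 : ℝ)) (fun j (t : Fin d × Fin d × Site d) => SideTouches (Ω j) t.2.2 t.2.1)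
          (fun t => covDerivFwd η U₀ t.1 (fun z => A' z t.2.1) t.2.2)
          ≤ B₀ * (bondNorm L k η (-(3 : ℝ)) Ω (fun x μ => Jcur η U₀ A' μ x)
          + wsup 1 (fun p : {p : ℕ × (Site d × Fin d) // p.1 ≤ k ∧ p.2 ∈ Λb k p.1} =>
          linCovIter L U₀ (iEta η A') p.1.1 p.1.2.1 p.1.2.2)) + Sg)
    -- THE SOURCE `f` OF (1.146): finite `|f|₍₋₂₎ ≤ m_f` on the `Ω_j`, PERIODIC on the full period lattice
    {f : Site d → 𝔸} {mf : ℝ} (hmf : 0 ≤ mf) (hf : Bd2 L η k Ω f mf) (hfP : ∀ x m : Site d, f (x + P • m) = f x)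
    -- Proposition 3's windows at `(α₀, α₂ := c⋆)` not implied by the JOIN's; EDITION γ: the (1.56) remainder constant `C₂ ≥ 8·131072(d+1)²·e^{4c·L²α₀}·L²`
    {C₂ : ℝ} (hside : 36 * d * B₀ * cs ≤ 1 / 2)
    (hC₂ : 8 * (131072 * ((d : ℝ) + 1) ^ 2) * Real.exp (4 * (800 * ((d : ℝ) + 1) ^ 2 * ((d : ℝ) + 4)) * ((L : ℝ) ^ 2 * α₀))
      * (L : ℝ) ^ 2 ≤ C₂)
    (h61 : 2 * cs ^ 2 + 20 * d * α₀ * cs + 2 * C₂ * cs ^ 2 ≤ α₀ + α₁) (hsmall₁ : (d : ℝ) * L * α₁ ≤ 1 / 8)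
    -- the [4] LETTERS at `(k, U₀)`, with the uniqueness laws AT PERIODIC ARGUMENTS and the periodicity-preservation laws
    (g Δ : (Site d → 𝔸) →ₗ[ℂ] (Site d → 𝔸)) (q : (Site d → 𝔸) →ₗ[ℂ] (ℕ → Site d → 𝔸)) (qs : (ℕ → Site d → 𝔸) →ₗ[ℂ] (Site d → 𝔸))
    (Aw c : (ℕ → Site d → 𝔸) →ₗ[ℂ] (ℕ → Site d → 𝔸))
    (g_leftB : ∀ x : Site d → 𝔸, (∀ (z : Site d) (i : Fin d), x (z + P • e i) = x z) → (∃ C : ℝ, ∀ y, ‖x y‖ ≤ C) →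
      g (Δ x + qs (Aw (q x))) = x)
    (c_left' : ∀ φ : ℕ → Site d → 𝔸, (∀ j, j ≤ k → ∀ (y : Site d) (i : Fin d), φ j (y + (P / (L : ℤ) ^ j) • e i) = φ j y) →
      qs (c (q (g (g (qs φ))))) = qs φ)
    (hΔ : ∀ (f : Site d → 𝔸), ∀ x ∈ Ω 0, Δ f x = covLap η U₀ ((Ω 0).indicator f) x)
    (hqs : ∀ (μ : ℕ → Site d → 𝔸), ∀ x ∈ Ω 0, qs μ x = QT L k (Λs k) U₀ μ x)
    (hq : ∀ (f : Site d → 𝔸) (j : ℕ), j ≤ k → ∀ y ∈ Λs k j, q f j y = QprimeIter (zdBlocking d L) (bgT L U₀) j f y)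
    (hq0 : ∀ (f : Site d → 𝔸) (j : ℕ) (y : Site d), ¬ (j ≤ k ∧ y ∈ Λs k j) → q f j y = 0)
    (hGper : ∀ (f : Site d → 𝔸) (z : Site d) (i : Fin d), g f (z + P • e i) = g f z)
    (hAw_per : ∀ μ : ℕ → Site d → 𝔸, (∀ j, j ≤ k → ∀ (y : Site d) (i : Fin d), Aw μ j (y + (P / (L : ℤ) ^ j) • e i) = Aw μ j y))
    (H' : XSpace d k 𝔸 →ₗ[ℂ] (Site d → 𝔸)) {B₀'H B₂' BG BR : ℝ} (hB₀'H : 0 < B₀'H) (hB₂' : 0 ≤ B₂') (hBG : 0 ≤ BG) (hBR : 0 ≤ BR)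
    (hH0 : ∀ (X : XSpace d k 𝔸) (x : Site d), ‖H' X x‖ ≤ B₀'H * ‖X‖)
    (hH1 : ∀ j, j ≤ k → ∀ (X : XSpace d k 𝔸), ∀ p ∈ {b : Site d × Fin d | SideTouches (Ω j) b.1 b.2},
      wt L η j * ‖covDerivFwd η U₀ p.2 (H' X) p.1‖ ≤ B₀'H * ‖X‖)
    (hH2 : ∀ X : XSpace d k 𝔸, Bd2 L η k Ω (covLap η U₀ (H' X)) (B₂' * ‖X‖))
    (hHper : ∀ X : XSpace d k 𝔸, (∀ (p : Fin (k + 1) × Site d) (i : Fin d), X (p.1, p.2 + (P / (L : ℤ) ^ (p.1 : ℕ)) • e i) = X p) →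
      ∀ (z : Site d) (i : Fin d), H' X (z + P • e i) = H' X z)
    (hQH : ∀ (Y : XSpace d k 𝔸), (∀ (p : Fin (k + 1) × Site d) (i : Fin d), Y (p.1, p.2 + (P / (L : ℤ) ^ (p.1 : ℕ)) • e i) = Y p) →
      ∀ (j : ℕ) (hj : j ≤ k) (y : Site d), y ∈ Λs k j →
      QprimeIter (zdBlocking d L) (bgT L U₀) j (H' Y) y = Y (⟨j, Nat.lt_succ_of_le hj⟩, y))
    (hG : ∀ (f : Site d → 𝔸) (r : ℝ), 0 ≤ r → Bd2 L η k Ω f r →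
      (∀ x, ‖g f x‖ ≤ BG * r) ∧ ∀ j, j ≤ k → ∀ p ∈ {b : Site d × Fin d | SideTouches (Ω j) b.1 b.2},
        wt L η j * ‖covDerivFwd η U₀ p.2 (g f) p.1‖ ≤ BG * r)
    (hRbd : ∀ (f : Site d → 𝔸) (r : ℝ), 0 ≤ r → Bd2 L η k Ω f r → Bd2 L η k Ω (f - g (qs (c (q (g f))))) (BR * r))
    -- the JOIN's scalar windows, one-for-one (`αP := α₀`, `α₄` free; `cB cA cDA` free above their datum values; `c_{DA} ≥ dL²(c⋆ + 2Sg)`)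
    {cB cA cDA : ℝ} (hcBlo : L * cs ≤ cB) (hcAlo : L * cs ≤ cA) (hcDAlo : (d : ℝ) * (L : ℝ) ^ 2 * (cs + 2 * Sg) ≤ cDA)
    (hα3 : C0 d * α₀ ≤ 1 / 3) (hα4 : 4 * α₀ ≤ c2' d L)
    -- EDITION γ: [3] Prop. 4's windows of the (1.42)∕(1.56) steps ONE LEVEL LOWER, at `(L²α₀, c_B)` (`c_B ≥ L·c⋆`)
    (hα3L : C0 d * ((L : ℝ) ^ 2 * α₀) ≤ 1 / 3) (hα4L : 4 * ((L : ℝ) ^ 2 * α₀) ≤ c2' d L)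
    (hsmallL : Real.exp (4 * (800 * ((d : ℝ) + 1) ^ 2 * ((d : ℝ) + 4)) * ((L : ℝ) ^ 2 * α₀)) * (1 + 8 * (131072 * ((d : ℝ) + 1) ^ 2) * cB) ≤ 2)
    (hsmall : Real.exp (4 * (800 * ((d : ℝ) + 1) ^ 2 * ((d : ℝ) + 4)) * α₀) * (1 + 8 * (131072 * ((d : ℝ) + 1) ^ 2) * cB) ≤ 2)
    (hc₃ : 2 * cB ≤ c3 d L) (hsc : 2048 * (d : ℝ) * cB ≤ 1) (hα₃' : 40 * d * cB ≤ 1 / 200)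
    (hs₁ : 200 * C6 d * (2 * α₄) ≤ 1) (hs₂ : 12000 * ((d : ℝ) + 1) * L * (2 * α₄) ≤ 1)
    (hs₃ : C4G d L * (α₀ + 40 * d * cB + 4 * (2 * α₄)) ≤ 1)
    (hs₄ : 1024 * ((d : ℝ) + 1) * ((d : ℝ) + 4) * L ^ 2 * α₀ ≤ 1) (hs₅ : 32 * ((d : ℝ) + 1) ^ 2 * C6 d * L ^ 2 * α₀ ≤ 1)
    (hs₆ : 16 * d * C5' d * C6 d * (L : ℝ) ^ 2 * α₀ ≤ 1) (hs₇ : 8 * d * C6 d * L * α₀ ≤ 1)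
    (hsm : 40 * d * cB + α₄ ≤ 1 / (4 * B₀'H * (2 * C2p d))) (hprod8 : 2 * C6 d * (40 * d * cB + 4 * α₄) ≤ 1 / 8)
    {hE hE₂ lE lE₂ : ℝ} (hE_def : hE = B₀'H * (C2p d * (40 * d * cB + α₄) * α₄)) (hE₂_def : hE₂ = B₂' * (C2p d * (40 * d * cB + α₄) * α₄))
    (lE_def : lE = B₀'H * (4 * C2p d * (40 * d * cB + 2 * α₄))) (lE₂_def : lE₂ = B₂' * (4 * C2p d * (40 * d * cB + 2 * α₄)))
    (hcA' : cA ≤ 1 / 13) (ha₁' : α₄ / 4 + hE ≤ 1 / 24) (hb₁' : α₄ / 4 + hE ≤ 1 / 140) (hθ : 10 * (α₄ / 4 + hE) * BR ≤ 1 / 2)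
    (h103 : BG * Mc d BR (α₄ / 4 + hE) cA (hE₂ + mf / 2) cDA ≤ α₄ / 4)
    (h106 : BG * Kc d BR (α₄ / 4 + hE) cA (hE₂ + mf / 2) cDA lE₂ (1 + lE) (1 + lE) ≤ 1 / 2)
    -- the two uniqueness windows: Lipschitz modulus of `H_c`, and the radius `c_u` of (1.109) against the ¼α₄-ball
    (hlE : lE ≤ 1 / 2) (hcu : cu + hE ≤ α₄ / 4)
    -- the competitors, with PERIODIC exponents
    {v w : Site d → 𝔸ˣ} {lam mu : Site d → 𝔸}
    (hlP : ∀ x m : Site d, lam (x + P • m) = lam x) (hmP : ∀ x m : Site d, mu (x + P • m) = mu x)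
    (hv : ∀ x, ((gaugeExp lam x : 𝔸ˣ) : 𝔸) = ((v x : 𝔸ˣ) : 𝔸) ∧ IsSelfAdjoint (lam x) ∧ ‖lam x‖ < cu)
    (hvD : ∀ j, j ≤ k → ∀ b ∈ {b : Site d × Fin d | SideTouches (Ω j) b.1 b.2}, ((L : ℝ) ^ j * η) * ‖covDerivFwd η U₀ b.2 lam b.1‖ < cu)
    (hw : ∀ x, ((gaugeExp mu x : 𝔸ˣ) : 𝔸) = ((w x : 𝔸ˣ) : 𝔸) ∧ IsSelfAdjoint (mu x) ∧ ‖mu x‖ < cu)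
    (hwD : ∀ j, j ≤ k → ∀ b ∈ {b : Site d × Fin d | SideTouches (Ω j) b.1 b.2}, ((L : ℝ) ^ j * η) * ‖covDerivFwd η U₀ b.2 mu b.1‖ < cu)
    -- each competitor's gauge-fixed field obeys THE MULTIPLIER FORM OF (1.146) at `k` levels (`B8Eq138LandauZd.IsLandau146W`'s second clause) and (1.29)
    (hLv : ∃ μ : ℕ → Site d → 𝔸, ∀ x ∈ Ω 0,
      covLap η U₀ ((Ω 0).indicator (covDivB η U₀ (logCfg η (mgauge U₀ v⁻¹ (mgauge U₀ u₁⁻¹ U'))) - f)) x = QT L k (Λs k) U₀ μ x)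
    (hRv : Restr129 L k (Λs k) U₀ (u₁ * v))
    (hLw : ∃ μ : ℕ → Site d → 𝔸, ∀ x ∈ Ω 0,
      covLap η U₀ ((Ω 0).indicator (covDivB η U₀ (logCfg η (mgauge U₀ w⁻¹ (mgauge U₀ u₁⁻¹ U'))) - f)) x = QT L k (Λs k) U₀ μ x)
    (hRw : Restr129 L k (Λs k) U₀ (u₁ * w)) :
    ∀ x, v x = w x := by
  subst hcs
  have hL1 : 1 ≤ L := le_trans (by norm_num) hL
  have hd1 : 1 ≤ d := le_trans (by norm_num) hd2
  have hLr : (1 : ℝ) ≤ L := by exact_mod_cast hL1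
  have hd0 : (1 : ℝ) ≤ d := by exact_mod_cast hd1
  have huniv : ∀ x, x ∈ Ω 0 := fun x => by rw [hΩ0]; exact Set.mem_univ x
  obtain ⟨k', rfl⟩ : ∃ k', k = k' + 1 := ⟨k - 1, (Nat.sub_add_cancel hk).symm⟩
  have hsum : 0 < α₀ + α₁ := add_pos hα₀ hα₁
  have hcs0 : 0 ≤ 5 * (d : ℝ) * L * B₀ * (α₀ + α₁) := by positivity
  have hcspos : 0 < 5 * (d : ℝ) * L * B₀ * (α₀ + α₁) := by positivity
  have hα₄pos : 0 < α₄ := hα₄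
  -- the engines' one-direction currency `z + P • e i` of the full-lattice periodicity data
  have hU₀per' : ∀ (z : Site d) (i : Fin d), U₀ (z + P • e i) = U₀ z := fun z i => hU₀per z (e i)
  have hu₁per' : ∀ (z : Site d) (i : Fin d), u₁ (z + P • e i) = u₁ z := fun z i => hu₁per z (e i)
  have hlP' : ∀ (z : Site d) (i : Fin d), lam (z + P • e i) = lam z := fun z i => hlP z (e i)
  have hmP' : ∀ (z : Site d) (i : Fin d), mu (z + P • e i) = mu z := fun z i => hmP z (e i)
  have hfP' : ∀ (z : Site d) (i : Fin d), f (z + P • e i) = f z := fun z i => hfP z (e i)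
  -- `c⋆ ≤ L·c⋆ ≤ cB`, hence Prop. 3's remaining windows from the JOIN's
  have hcsB : 5 * (d : ℝ) * L * B₀ * (α₀ + α₁) ≤ cB := (le_mul_of_one_le_left hcs0 hLr).trans hcBlo
  have hcB0 : 0 ≤ cB := hcs0.trans hcsB
  have hcA0 : 0 ≤ cA := (hcs0.trans (le_mul_of_one_le_left hcs0 hLr)).trans hcAlo
  have hcDA0 : 0 ≤ cDA := le_trans (by positivity) hcDAlo
  have hcBsmall : (d : ℝ) * cB ≤ 1 / 8000 := by linarith only [hα₃']
  have hdcs : (d : ℝ) * (5 * (d : ℝ) * L * B₀ * (α₀ + α₁)) ≤ 1 / 8000 :=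
    (mul_le_mul_of_nonneg_left hcsB (by positivity)).trans hcBsmall
  have hcs8000 : 5 * (d : ℝ) * L * B₀ * (α₀ + α₁) ≤ 1 / 8000 := (le_mul_of_one_le_left hcs0 hd0).trans hdcs
  have h16 : 16 * (5 * (d : ℝ) * L * B₀ * (α₀ + α₁)) ≤ 1 := by linarith only [hcs8000]
  have h50 : 50 * d * (5 * (d : ℝ) * L * B₀ * (α₀ + α₁)) ≤ 1 := by linarith only [hdcs]
  have hd5 : 5 * (5 * (d : ℝ) * L * B₀ * (α₀ + α₁)) * ((d : ℝ) - 1) ≤ 4 := by nlinarith only [hdcs, hcs0]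
  have hαP2 : 2 * α₀ ≤ c2' d L := by linarith only [hα4, hα₀]
  -- EDITION γ: the (1.42)∕(1.56) windows at `(L²α₀, L·c⋆)` from `L·c⋆ ≤ c_B`
  have hLcs : (L : ℝ) * (5 * (d : ℝ) * L * B₀ * (α₀ + α₁)) ≤ cB := hcBlo
  have hcB1 : cB ≤ (d : ℝ) * cB := le_mul_of_one_le_left hcB0 hd0
  have h16L : 16 * ((L : ℝ) * (5 * (d : ℝ) * L * B₀ * (α₀ + α₁))) ≤ 1 := by linarith only [hLcs, hcBsmall, hcB1]
  have hc₃3L : 2 * ((L : ℝ) * (5 * (d : ℝ) * L * B₀ * (α₀ + α₁))) ≤ c3 d L := by linarith only [hc₃, hLcs]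
  have hsmall3L : Real.exp (4 * (800 * ((d : ℝ) + 1) ^ 2 * ((d : ℝ) + 4)) * ((L : ℝ) ^ 2 * α₀)) *
      (1 + 8 * (131072 * ((d : ℝ) + 1) ^ 2) * ((L : ℝ) * (5 * (d : ℝ) * L * B₀ * (α₀ + α₁)))) ≤ 2 := by
    refine le_trans (mul_le_mul_of_nonneg_left ?_ (Real.exp_pos _).le) hsmallL
    have h := mul_le_mul_of_nonneg_left hLcs (show (0 : ℝ) ≤ 8 * (131072 * ((d : ℝ) + 1) ^ 2) by positivity)
    linarith only [h]
  have hC2 : 0 ≤ C2p d := B8Ineq125Concrete.C2p_nonneg d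
  have hhE : 0 ≤ hE := by rw [hE_def]; positivity
  -- the datum `U₁ = U′^{u₁⁻¹}`: unitary, PERIODIC on the full period lattice, `U₁^{u₁} = U′`, and its Hermitian logarithm on the touched bonds
  set U₁ : Site d → Fin d → 𝔸ˣ := mgauge U₀ u₁⁻¹ U' with hU₁def
  have hW : mgauge U₀ u₁ U₁ = U' := mgauge_mgauge_inv U₀ U' u₁
  have hWu : ∀ x κ, U₁ x κ ∈ unitaryUnits 𝔸 := mem_unitaryUnits_of_mgauge_eq hU₀ hU' hu₁ hW
  have hU₁P : ∀ x m : Site d, U₁ (x + P • m) = U₁ x := fun x m => funext fun κ =>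
    mgauge_periodic (p := P • m) (fun y κ => by rw [hU₀per y m]) (fun y κ => by rw [hU'per y m])
      (fun y => by rw [Pi.inv_apply, Pi.inv_apply, hu₁per y m]) x κ
  obtain ⟨A₁, hA₁⟩ := hdat
  have hdat' : ∀ j, j ≤ k' + 1 → ∀ b ∈ {b : Site d × Fin d | SideTouches (Ω j) b.1 b.2},
      U₁ b.1 b.2 = cfgExp η (logCfg η U₁) b.1 b.2 ∧ IsSelfAdjoint (logCfg η U₁ b.1 b.2) ∧
        ‖logCfg η U₁ b.1 b.2‖ ≤ (5 * (d : ℝ) * L * B₀ * (α₀ + α₁)) * ((L : ℝ) ^ j * η)⁻¹ := by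
    intro j hj b hb
    obtain ⟨hexp, hbd⟩ := hA₁ j hj b.1 b.2 hb
    have hbd' : ‖A₁ b.1 b.2‖ ≤ (5 * (d : ℝ) * L * B₀ * (α₀ + α₁)) * η⁻¹ := by
      refine hbd.trans ?_
      have hLj : (1 : ℝ) ≤ (L : ℝ) ^ j := one_le_pow₀ hLr
      have : ((L : ℝ) ^ j * η)⁻¹ ≤ η⁻¹ := by
        rw [mul_inv]
        calc ((L : ℝ) ^ j)⁻¹ * η⁻¹ ≤ 1 * η⁻¹ := by gcongr; exact inv_le_one_of_one_le₀ hLj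
          _ = η⁻¹ := one_mul _
      exact mul_le_mul_of_nonneg_left this hcs0
    obtain ⟨hlogA, hsa, hWexp⟩ := logField_spec hη U₀ hWu hexp hbd' (by linarith only [h16])
    refine ⟨hWexp, ?_, ?_⟩
    · simpa [logCfg] using hsa
    · show ‖logCfg η U₁ b.1 b.2‖ ≤ _
      rw [logCfg, hlogA]
      exact hbd
  -- the MASKED exponent `A′` (globally Hermitian); at `Ω 0 = univ` every bond is touched, so `U₁ = e^{iηA′}` GLOBALLY and `A′` is periodic on the full lattice
  obtain ⟨A', hsa, hA'eq, hWA, hA0⟩ := exists_masked_datum hdat'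
  have hWA1 : ∀ j, j ≤ k' → ∀ (y : Site d) (τ : Fin d), SideTouches (Ω j) y τ → U₁ y τ = cfgExp η A' y τ :=
    fun j hj y τ hs => (hWA j (Nat.le_succ_of_le hj) y τ hs).1
  have h41 : ∀ j, j ≤ k' → ∀ (y : Site d) (τ : Fin d), SideTouches (Ω j) y τ →
      ‖A' y τ‖ ≤ (5 * (d : ℝ) * L * B₀ * (α₀ + α₁)) * ((L : ℝ) ^ j * η)⁻¹ := fun j hj y τ hs => (hWA j (Nat.le_succ_of_le hj) y τ hs).2
  have htouch0 : ∀ (y : Site d) (τ : Fin d), SideTouches (Ω 0) y τ := fun y τ => (sideTouches_pair_of_mem hd2 (huniv y) τ).1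
  have hU₁eq : U₁ = cfgExp η A' := funext fun y => funext fun τ => (hWA 0 (Nat.zero_le _) y τ (htouch0 y τ)).1
  have hA'0 : ∀ (y : Site d) (τ : Fin d), ‖A' y τ‖ ≤ (5 * (d : ℝ) * L * B₀ * (α₀ + α₁)) * η⁻¹ := fun y τ => by
    have h := (hWA 0 (Nat.zero_le _) y τ (htouch0 y τ)).2
    rwa [pow_zero, one_mul] at h
  have hA'per : ∀ x m : Site d, A' (x + P • m) = A' x := fun x m => funext fun τ => by
    rw [hA'eq 0 (Nat.zero_le _) _ τ (htouch0 _ τ), hA'eq 0 (Nat.zero_le _) x τ (htouch0 x τ), logCfg, logCfg, hU₁P x m]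
  have hA'per' : ∀ (z : Site d) (i : Fin d), A' (z + P • e i) = A' z := fun z i => hA'per z (e i)
  -- the JOIN's datum binders BY NAME (`B8Prop5SocketDatum` §7, §3–§4)
  have h33' := h33_of_inAk hL1 hα₀ h33 le_rfl htower
  have hP' := hP_of_datum hL1 hα₀ hΩ h34 le_rfl htower hu₁ hW hWA1
  have h69' : ∀ j, j ≤ k' + 1 → ∀ y ∈ Λs (k' + 1) j, ∀ (x : Site d) (κ : Fin d), InBox (tlo L y j) (thi L y j) x →
      InBox (tlo L y j) (thi L y j) (x + e κ) → ‖iEta η A' x κ‖ ≤ cB * ((L : ℝ) ^ j)⁻¹ :=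
    fun j hj y hy x κ hx hxe =>
      (h69_of_datum hd2 hL1 hη hΩ htower hcs0 h41 j hj y hy x κ hx hxe).trans (mul_le_mul_of_nonneg_right hcBlo (by positivity))
  have hAd : ∀ j, j ≤ k' + 1 → ∀ x ∈ Ω j, ∀ μ : Fin d,
      wt L η j * ‖A' x μ‖ ≤ cA ∧ wt L η j * ‖conjR (U₀ (x - e μ) μ)⁻¹ (A' (x - e μ) μ)‖ ≤ cA := fun j hj x hx μ =>
    ⟨(hA_of_datum hd2 hL1 hη hΩ hU₀ hcs0 h41 j hj x hx μ).1.trans hcAlo, (hA_of_datum hd2 hL1 hη hΩ hU₀ hcs0 h41 j hj x hx μ).2.trans hcAlo⟩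
  have hBu : ∀ (x : Site d) (κ : Fin d), expCfg (iEta η A') x κ ∈ unitaryUnits 𝔸 := expCfg_iEta_mem_unitaryUnits η hsa
  have hexpA : expCfg (iEta η A') = U₁ := by rw [expCfg_iEta_eq_cfgExp, hU₁eq]
  have hAx' : InAx L (k' + 1) (Λs (k' + 1)) U₀ (mgauge U₀ u₁ (expCfg (iEta η A')) * U₀) := by
    rw [hexpA, hW, ← mulCfg_eq_mul]
    exact hAx (k' + 1) le_rfl
  -- the source `D*A′`: (1.69)'s gradient member by Proposition 3 WITH SOURCE at the top level on the SOURCED b9 lines at the periodic `A′` (edition γ′),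
  -- then `|D*A′|₍₋₂₎ ≤ d·L²·(c⋆ + 2Sg) ≤ cDA`
  obtain ⟨h59a, h59g⟩ := SH59k A' hA'per hsa hWA hA0
  have hgrad := grad_bound_of_datum_src_γ' hd2 hη hL (k' + 1) hU₀ hU' hα₀ hα₁ hcspos hB₀.le hα3L hα4L h16L hd5 hsmall3L hc₃3L hside h50
    hC₂ h61 hsmall₁ Ω hΩ Λs Λb hbox hclass h33 h34 hAx h135 hk le_rfl htower Lan hu₁ hW h129 hLan hsa hWA hA0 h59a h59g
  have hcsS : 0 ≤ 5 * (d : ℝ) * L * B₀ * (α₀ + α₁) + 2 * Sg := by positivity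
  have hDA : Bd2 L η (k' + 1) Ω (fun y => covDivB η U₀ A' y) cDA := fun j hj x hx =>
    (bd2_covDivB_of_grad hd2 hL1 hη hΩ hU₀ hcsS (fun j hj y κ τ hs => hgrad j (Nat.le_succ_of_le hj) y κ τ hs) j hj x hx).trans hcDAlo
  -- the JOIN's bond classes `Eb j := {b ∣ SideTouches (Ω j) b}` (§6)
  have hEbΩ : ∀ j, j ≤ k' + 1 → ∀ x ∈ Ω j, ∀ μ : Fin d, (x, μ) ∈ {b : Site d × Fin d | SideTouches (Ω j) b.1 b.2} ∧
      (x - e μ, μ) ∈ {b : Site d × Fin d | SideTouches (Ω j) b.1 b.2} := fun j _ x hx μ => sideTouches_pair_of_mem hd2 hx μ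
  have hEbT : ∀ j, j ≤ k' + 1 → ∀ y ∈ Λs (k' + 1) j, ∀ (x : Site d) (κ : Fin d), InBox (tlo L y j) (thi L y j) x →
      InBox (tlo L y j) (thi L y j) (x + e κ) → (x, κ) ∈ {b : Site d × Fin d | SideTouches (Ω j) b.1 b.2} :=
    fun j hj y hy x κ hx _ => sideTouches_of_tower_bond hd2 htower hj hy x κ hx
  -- each competitor: `v = e^{iλ}` globally with `λ` periodic (given); its (1.146) of record is the SOURCED multiplier clause of `HFP` at `A′` by the
  -- D*-identity (source untouched), with a LEVEL-PERIODIC multiplier (the left side is periodic — `U₀`, `A′`, `λ`, `f` are; `Q′ᵀ` is block-local and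
  -- translation covariant)
  have hcu4 : cu ≤ α₄ / 4 := by linarith only [hcu, hhE]
  have hcu12 : cu ≤ 1 / 12 := by linarith only [hcu4, ha₁', hhE]
  have hcu70 : cu ≤ 1 / 70 := by linarith only [hcu4, hb₁', hhE]
  have hcomp : ∀ (vv : Site d → 𝔸ˣ) (ll : Site d → 𝔸), (∀ (z : Site d) (i : Fin d), ll (z + P • e i) = ll z) →
      (∀ x, ((gaugeExp ll x : 𝔸ˣ) : 𝔸) = ((vv x : 𝔸ˣ) : 𝔸) ∧ IsSelfAdjoint (ll x) ∧ ‖ll x‖ < cu) →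
      (∀ j, j ≤ k' + 1 → ∀ b ∈ {b : Site d × Fin d | SideTouches (Ω j) b.1 b.2}, ((L : ℝ) ^ j * η) * ‖covDerivFwd η U₀ b.2 ll b.1‖ < cu) →
      (∃ μ : ℕ → Site d → 𝔸, ∀ x ∈ Ω 0,
        covLap η U₀ ((Ω 0).indicator (covDivB η U₀ (logCfg η (mgauge U₀ vv⁻¹ (mgauge U₀ u₁⁻¹ U'))) - f)) x = QT L (k' + 1) (Λs (k' + 1)) U₀ μ x) →
      vv = gaugeExp ll ∧ (∀ x, ‖ll x‖ ≤ cu) ∧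
      (∀ j, j ≤ k' + 1 → ∀ p ∈ {b : Site d × Fin d | SideTouches (Ω j) b.1 b.2}, wt L η j * ‖covDerivFwd η U₀ p.2 ll p.1‖ ≤ cu) ∧
      (∃ μ : ℕ → Site d → 𝔸, (∀ j, j ≤ k' + 1 → ∀ (y : Site d) (i : Fin d), μ j (y + (P / (L : ℤ) ^ j) • e i) = μ j y) ∧ ∀ x ∈ Ω 0,
        covLap η U₀ ((Ω 0).indicator fun y => covDivB η U₀ A' y + covLap η U₀ ll y +
          ((conjR (gaugeExp ll y)⁻¹ (covDivB η U₀ A' y) - covDivB η U₀ A' y) +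
            (gAd (covLap η U₀ ll y) (ll y) - covLap η U₀ ll y) + ∑ μ, frakF3 η U₀ ll A' y μ) - f y) x = QT L (k' + 1) (Λs (k' + 1)) U₀ μ x) := by
    intro vv ll hllP hll hllD hL146
    have hveq : vv = gaugeExp ll := funext fun x => (Units.ext (hll x).1).symm
    refine ⟨hveq, fun x => (hll x).2.2.le, fun j hj p hp => (hllD j hj p hp).le, ?_⟩
    -- the multiplier form of (1.146) for `U₁^{v⁻¹} = (e^{iηA′})^{(e^{iλ})⁻¹}`, rewritten by the D*-identity on `Ω₀` (the source term is untouched)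
    have hL' : ∃ μ : ℕ → Site d → 𝔸, ∀ x ∈ Ω 0,
        covLap η U₀ ((Ω 0).indicator (covDivB η U₀ (logCfg η (mgauge U₀ (gaugeExp ll)⁻¹ (cfgExp η A'))) - f)) x =
          QT L (k' + 1) (Λs (k' + 1)) U₀ μ x := by
      rw [← hveq, ← hU₁eq]; exact hL146
    obtain ⟨μ, hμ⟩ := hL'
    -- the left side is `P`-periodic: a level-periodic representative of the multiplier
    set W : Site d → Fin d → 𝔸ˣ := mgauge U₀ (gaugeExp ll)⁻¹ (cfgExp η A') with hWdef
    have hWP : ∀ (z : Site d) (i : Fin d), W (z + P • e i) = W z := fun z i => funext fun κ =>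
      mgauge_periodic (p := P • e i) (fun x κ => by rw [hU₀per' x i])
        (fun x κ => by show cfgExp η A' (x + P • e i) κ = cfgExp η A' x κ; unfold cfgExp; rw [hA'per' x i])
        (fun x => by rw [Pi.inv_apply, Pi.inv_apply, gaugeExp_per hllP x i]) z κ
    have hlogP : ∀ (z : Site d) (i : Fin d), logCfg η W (z + P • e i) = logCfg η W z := fun z i => funext fun κ => by
      show logCfg η W (z + P • e i) κ = logCfg η W z κ
      unfold logCfg; rw [hWP z i]
    have hFP : ∀ (z : Site d) (i : Fin d),
        covLap η U₀ ((Ω 0).indicator (covDivB η U₀ (logCfg η W) - f)) (z + P • e i) =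
          covLap η U₀ ((Ω 0).indicator (covDivB η U₀ (logCfg η W) - f)) z := by
      rw [hΩ0, Set.indicator_univ]
      exact covLap_per hU₀per' (fun z i => by rw [Pi.sub_apply, Pi.sub_apply, covDivB_per hU₀per' hlogP z i, hfP' z i])
    obtain ⟨μ', hμ'per, hμ'⟩ := exists_levelPeriodic_multiplier hL1 (k' + 1) hdiv hΛ hU₀per' hFP (fun x => hμ x (huniv x))
    refine ⟨μ', hμ'per, fun x hx => ?_⟩
    have hind : ((Ω 0).indicator fun y => covDivB η U₀ A' y + covLap η U₀ ll y +
        ((conjR (gaugeExp ll y)⁻¹ (covDivB η U₀ A' y) - covDivB η U₀ A' y) +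
          (gAd (covLap η U₀ ll y) (ll y) - covLap η U₀ ll y) + ∑ μ, frakF3 η U₀ ll A' y μ) - f y) =
        (Ω 0).indicator (covDivB η U₀ (logCfg η (mgauge U₀ (gaugeExp ll)⁻¹ (cfgExp η A'))) - f) := by
      refine Set.indicator_congr fun y _ => ?_
      have hly : ‖ll y‖ ≤ 1 / 12 := (hll y).2.2.le.trans hcu12
      have hDy : ∀ ν : Fin d, η * ‖covDerivFwd η U₀ ν ll y‖ ≤ 1 / 70 := fun ν => by
        have h := (hllD 0 (Nat.zero_le _) (y, ν) (htouch0 y ν)).le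
        rw [pow_zero, one_mul] at h
        exact h.trans hcu70
      have hay : ∀ ν : Fin d, η * ‖covDeriv η U₀ ν ll y‖ ≤ 1 / 70 := fun ν => by
        rw [norm_covDeriv_eq hU₀]
        have h := (hllD 0 (Nat.zero_le _) (y - e ν, ν) (htouch0 (y - e ν) ν)).le
        rw [pow_zero, one_mul] at h
        exact h.trans hcu70
      have hYy : ∀ ν : Fin d, η * ‖conjR (U₀ (y - e ν) ν)⁻¹ (A' (y - e ν) ν)‖ ≤ 1 / 12 := fun ν => by
        have hu : ((U₀ (y - e ν) ν)⁻¹ : 𝔸ˣ) ∈ U1 𝔸 := (U1 𝔸).inv_mem (unitaryUnits_le_U1 (hU₀ _ ν))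
        rw [norm_conjR hu]
        calc η * ‖A' (y - e ν) ν‖ ≤ η * ((5 * (d : ℝ) * L * B₀ * (α₀ + α₁)) * η⁻¹) := mul_le_mul_of_nonneg_left (hA'0 _ ν) hη.le
          _ = 5 * (d : ℝ) * L * B₀ * (α₀ + α₁) := by field_simp
          _ ≤ 1 / 12 := by linarith only [h16]
      rw [Pi.sub_apply, (covDivB_logCfg_gaugeFixed hη U₀ A' hly hDy hay hYy).symm]
    rw [hind]
    exact hμ' x
  obtain ⟨hveq, hl₁, hD₁, hmult₁⟩ := hcomp v lam hlP' hv hvD hLv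
  obtain ⟨hweq, hl₂, hD₂, hmult₂⟩ := hcomp w mu hmP' hw hwD hLw
  have hR₁ : Restr129 L (k' + 1) (Λs (k' + 1)) U₀ (u₁ * gaugeExp lam) := by rw [← hveq]; exact hRv
  have hR₂ : Restr129 L (k' + 1) (Λs (k' + 1)) U₀ (u₁ * gaugeExp mu) := by rw [← hweq]; exact hRw
  -- unitary Λ_j-witnesses for `u₁` (Theorem 4's inductive gauge transformation) at class constant `40d·c_B`, from (1.34), (1.29)
  have hα₃0 : (0 : ℝ) ≤ 40 * d * cB := by positivity
  have hwit : ∀ j, j ≤ k' + 1 → ∀ y ∈ Λs (k' + 1) j, ∃ ut : Site d → 𝔸ˣ, (∀ x, ut x ∈ unitaryUnits 𝔸) ∧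
      InLambda L (clampCfg (tlo L y j) (thi L y j) U₀) ut j (40 * d * cB) (((L : ℝ) ^ j)⁻¹) ∧
      ∀ x : Site d, tlo L y j ≤ x → x ≤ thi L y j → u₁ x = ut x := fun j hj y hy =>
    witness_unitary_of_glev hd1 hL hU₀ hα₀ hα3 hα4 (h33' j hj y hy) hcB0 hsmall hc₃ hsc hα₀ hα3 hαP2 hL1 hBu (h69' j hj y hy) (hP' j hj y hy)
      (glev_on_towers_of_axial hL1 (Λs (k' + 1)) hAx' h129 j hj y hy)
  -- THE SOURCED UNIQUENESS JOIN ON THE TORUS, (U1)/(U2)/(1.91) AT PERIODIC ARGUMENTS (`hFP_unique_of_sectE_local_wb_src_per`, BY NAME) at `ρ := c_u`,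
  -- `α₃ := 40d·c_B`, source `f`
  have heq : lam = mu := hFP_unique_of_sectE_local_wb_src_per (Ω := Ω) (Λs := Λs (k' + 1)) (f := f)
    (Eb := fun j => {b : Site d × Fin d | SideTouches (Ω j) b.1 b.2}) (u₁ := u₁) (A := A') hL hη hU₀ P hΩ0 hEbΩ hEbT g Δ q qs Aw c g_leftB
    c_left' hΔ hqs hq hq0 hdiv hΛ hU₀per' hA'per' hu₁per' hGper hAw_per H' hα₀ hα3 hα4 hα₃0 hα₄pos hB₀'H hB₂' h33' hwit h129 hH0 hH1 hH2 hHper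
    hQH hα₃' hs₁ hs₂ hs₃ hs₄ hs₅ hs₆ hs₇ hsm hprod8 hE_def hE₂_def lE_def lE₂_def hBG hBR hcA0 hcA' hcDA0 ha₁' hb₁' hθ hlE hcu hG hRbd hDA hmf hf
    hfP' hAd h103 h106 hlP' hl₁ hD₁ hmult₁ hR₁ hmP' hl₂ hD₂ hmult₂ hR₂
  intro x
  rw [hveq, hweq, heq]

#print axioms sockP5uE_body_src_γ'_per

end Literature.MathematicalPhysics.QuantumFieldTheory.Balaban1983to89.B8SockP5uEBodyNestedSrcPer

end
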